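import Literature.NumberTheory.EllipticCurves.ZpExtensionEisensteinTwistDualityForm
import Literature.NumberTheory.GaloisCohomology.Howard2004.SelmerTriples
import HarnessLib

/-!
# The H.4 duality datum of the Eisenstein levels `E[p^k] ⊗ A_{m,k}(ψ)` as a `Howard2004.DualityDatum`

Topic `NumberTheory/EllipticCurves` (sequel to `ZpExtensionEisensteinTwistDualityForm`; consumer-facing packaging for the
cell's (W9)-A structure `Literature.NumberTheory.GaloisCohomology.Howard2004.DualityDatum`). Definitions with bodies +
theorems; no named fact, no notation, no `sorry`. TWO INSTANCES on the cell's own level ring `A_{m,k} =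
IwasawaAlgebra.EisensteinCoeff p m k` (the DISCRETE topology `⊥` and `DiscreteTopology`), required by the signature of
`DualityDatum` (`[TopologicalSpace R] [DiscreteTopology R]`, and `twistOne : DiscreteGaloisModule K R`); they introduce
no mathematics and no diamond (the tree had no topology on `EisensteinCoeff`).

* `ZpExtension.eisensteinTwistOne hm k : DiscreteGaloisModule K A_{m,k}` — `R(1)`: `g` acts by multiplication by
  `ι(χ_cyc(g) mod p^k)`, i.e. by `algebraMap ℤ_[p] A_{m,k} (χ_cyc g)` (`eisensteinTwistOne_apply`, the PINNED form
  `twistOne_apply`); continuity as the tree's `tateTwist`.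
* **`ZpExtension.eisensteinDualityDatum`**: for a conjugation datum `cd`, a twist `κ'` with OPPOSITE exponents along
  `cd.conj` (anticyclotomic), and an `E`-level form `ẽ : M × M → ℤ/p^k` that is symmetric, `(g, cd.conj g)`-equivariant
  with the mod-`p^k` cyclotomic factor, left-non-degenerate and exhausting (e.g. `conjPairing` of
  `ConjugatePairingDuality` from the Weil pairing and `τ`), the datum
  `DualityDatum p cd (κ'.eisensteinTwist ρ hm k) A_{m,k}` with `e = eisensteinDualityForm hm k ẽ` — hypothesis H.4's
  module part for `T_𝔮/p^k T_𝔮`, `𝔮 = (T^m + p)`, BY NAME. The local clause `DualityDatum.IsSelfOrthogonal` (the rest of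
  H.4) is about the Selmer structure `F_𝔮` and is not asserted here.

References: [Howard2004HeegnerKolyvagin] B. Howard, Compositio Math. 140 (2004), §1.3 H.4, Rem. 1.3.2, Lemma 2.1.1, §2.2.
-/

noncomputable section

open scoped TensorProduct
open Field

namespace Literature.NumberTheory.EllipticCurves

open Literature.NumberTheory.GaloisRepresentations Literature.NumberTheory.GaloisCohomology.Howard2004

namespace IwasawaAlgebra.EisensteinCoeff

variable (p : ℕ) [Fact p.Prime] (m k : ℕ)

/-- The DISCRETE topology on the finite level ring `A_{m,k}` (required by the signature of the cell's
`Howard2004.DualityDatum` / `DiscreteGaloisModule K R`; Howard's coefficient rings at finite level are finite discrete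
rings). [cite: Howard2004HeegnerKolyvagin, §1.3 (H.4: R(1) as a G_K-module)] -/
instance instTopologicalSpace : TopologicalSpace (EisensteinCoeff p m k) := ⊥

/-- The topology on `A_{m,k}` is discrete by definition. [cite: Howard2004HeegnerKolyvagin, §1.3 (H.4)] -/
instance instDiscreteTopology : DiscreteTopology (EisensteinCoeff p m k) := ⟨rfl⟩

end IwasawaAlgebra.EisensteinCoeff

namespace ZpExtension

open IwasawaAlgebra

variable {K : Type} [Field K] {p : ℕ} [hp : Fact p.Prime] {m : ℕ} (hm : 1 ≤ m) (k : ℕ)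

/-- The representation `g ↦ (r ↦ ι(χ_cyc(g) mod p^k) · r)` of `Γ_K` on `A_{m,k}` underlying `R(1)`.
[cite: Howard2004HeegnerKolyvagin, §1.3 (H.4: the Tate twist R(1))] -/
def eisensteinTwistOneRepresentation : Representation ℤ (absoluteGaloisGroup K) (EisensteinCoeff p m k) where
  toFun g := (AddMonoidHom.mulLeft (EisensteinCoeff.ofZMod p hm k (cyclotomicCharacterModPow K p k g))).toIntLinearMap
  map_one' := by
    refine LinearMap.ext fun r => ?_
    simp [map_one]
  map_mul' g h := by
    refine LinearMap.ext fun r => ?_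
    simp [map_mul, mul_assoc]

/-- Unfolding: `eisensteinTwistOneRepresentation g r = ι(χ̄ g) * r`. [cite: Howard2004HeegnerKolyvagin, §1.3 (H.4)] -/
@[simp]
theorem eisensteinTwistOneRepresentation_apply_apply (g : absoluteGaloisGroup K) (r : EisensteinCoeff p m k) :
    eisensteinTwistOneRepresentation (K := K) hm k g r =
      EisensteinCoeff.ofZMod p hm k (cyclotomicCharacterModPow K p k g) * r := rfl

/-- **`A_{m,k}(1)`** — the level ring with `Γ_K` acting through the `p`-adic cyclotomic character reduced modulo `p^k`
(a discrete Galois module: the stabiliser of `r` contains the open kernel of `χ_cyc mod p^k`).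
[cite: Howard2004HeegnerKolyvagin, §1.3 (H.4: «R(1) the Tate twist of the module R with trivial Galois action»)] -/
def eisensteinTwistOne : DiscreteGaloisModule K (EisensteinCoeff p m k) :=
  ContinuousRep.ofStabilizerMemNhdsOne (eisensteinTwistOneRepresentation (K := K) hm k) fun r => by
    have h1 : {σ : absoluteGaloisGroup K | cyclotomicCharacterModPow K p k σ = 1} ∈ nhds (1 : absoluteGaloisGroup K) :=
      ((isOpen_discrete ({1} : Set (ZMod (p ^ k)))).preimage
        (continuous_cyclotomicCharacterModPow K p k)).mem_nhds (by simp)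
    filter_upwards [h1] with σ hσ
    rw [eisensteinTwistOneRepresentation_apply_apply, hσ, map_one, one_mul]

/-- **`twistOne_apply` (PINNED form)**: `g · r = algebraMap ℤ_[p] A_{m,k} (χ_cyc g) * r`.
[cite: Howard2004HeegnerKolyvagin, §1.3 (H.4)] -/
theorem eisensteinTwistOne_apply (g : absoluteGaloisGroup K) (r : EisensteinCoeff p m k) :
    eisensteinTwistOne (K := K) hm k g r =
      algebraMap ℤ_[p] (EisensteinCoeff p m k) ((GaloisRep.cyclotomicCharacter K p g : ℤ_[p]ˣ) : ℤ_[p]) * r := by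
  change eisensteinTwistOneRepresentation (K := K) hm k g r = _
  rw [eisensteinTwistOneRepresentation_apply_apply, EisensteinCoeff.algebraMap_padicInt_eq_ofZMod_toZModPow p hm k,
    cyclotomicCharacterModPow_apply]

variable [NumberField K] (cd : ConjugationDatum K) (κ' : ZpExtension K p)
  {M : Type} [AddCommGroup M] [TopologicalSpace M] [DiscreteTopology M] (ρ : DiscreteGaloisModule K M)
  (eb : M →+ M →+ ZMod (p ^ k))

/-- **The H.4 duality datum of the Eisenstein level `M ⊗ A_{m,k}(ψ_{κ'})`** (`M = E[p^k]`: Howard's `T_𝔮/p^k T_𝔮` with its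
pairing `e_𝔮(t₁ ⊗ α₁, t₂ ⊗ α₂) = e(t₁, t₂^τ) α₁ α₂`), assembled BY NAME from `eisensteinDualityForm` and its landed
properties: `symm` ← `eisensteinDualityForm_symm`, `perfect` ← `eisensteinDualityForm_bijective`, `equivariant` ←
`eisensteinDualityForm_equivariant_cyclotomic`, `twistOne` ← `eisensteinTwistOne`. Inputs: an `E`-level form
`ẽ : M × M → ℤ/p^k` symmetric, `(g, τgτ⁻¹)`-equivariant with the mod-`p^k` cyclotomic factor, left-non-degenerate and
exhausting `Hom(M, ℤ/p^k)` (tree `conjPairing` of the Weil pairing and a complex conjugation), and OPPOSITE twist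
exponents of `κ'` along `cd.conj` (`κ'` anticyclotomic: `twistExponent_add_twistExponent_conj_dvd`).
[cite: Howard2004HeegnerKolyvagin, §1.3 (H.4), Rem. 1.3.2, Lemma 2.1.1, §2.2 (T_𝔮 at 𝔮 = T^m + p)] -/
def eisensteinDualityDatum (hsymm : ∀ a b : M, eb a b = eb b a)
    (hequiv : ∀ (g : absoluteGaloisGroup K) (a b : M), eb (ρ g a) (ρ (cd.conj g) b) = cyclotomicCharacterModPow K p k g * eb a b)
    (hnd : ∀ w : M, (∀ b : M, eb w b = 0) → w = 0) (hex : ∀ φ : M →+ ZMod (p ^ k), ∃ w : M, ∀ b : M, eb w b = φ b)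
    (hκ : ∀ g : absoluteGaloisGroup K,
      p ^ eisensteinLevel (p := p) hm k ∣ κ'.twistExponent (eisensteinLevel (p := p) hm k) g +
        κ'.twistExponent (eisensteinLevel (p := p) hm k) (cd.conj g)) :
    DualityDatum p cd (κ'.eisensteinTwist ρ hm k) (EisensteinCoeff p m k) where
  e := eisensteinDualityForm hm k eb
  symm := eisensteinDualityForm_symm hm k eb hsymm
  perfect := eisensteinDualityForm_bijective hm k eb hnd hex
  equivariant g s t := eisensteinDualityForm_equivariant_cyclotomic hm k κ' ρ cd.conj eb hκ hequiv g s t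
  twistOne := eisensteinTwistOne (K := K) hm k
  twistOne_apply := eisensteinTwistOne_apply (K := K) hm k

/-- The pairing of the datum is `eisensteinDualityForm` (by `rfl`). [cite: Howard2004HeegnerKolyvagin, Lemma 2.1.1] -/
theorem eisensteinDualityDatum_e (hsymm : ∀ a b : M, eb a b = eb b a)
    (hequiv : ∀ (g : absoluteGaloisGroup K) (a b : M), eb (ρ g a) (ρ (cd.conj g) b) = cyclotomicCharacterModPow K p k g * eb a b)
    (hnd : ∀ w : M, (∀ b : M, eb w b = 0) → w = 0) (hex : ∀ φ : M →+ ZMod (p ^ k), ∃ w : M, ∀ b : M, eb w b = φ b)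
    (hκ : ∀ g : absoluteGaloisGroup K,
      p ^ eisensteinLevel (p := p) hm k ∣ κ'.twistExponent (eisensteinLevel (p := p) hm k) g +
        κ'.twistExponent (eisensteinLevel (p := p) hm k) (cd.conj g)) :
    (eisensteinDualityDatum hm k cd κ' ρ eb hsymm hequiv hnd hex hκ).e = eisensteinDualityForm hm k eb := rfl

/-- On pure tensors the datum's pairing is Howard's formula `(c₁ ⊗ a₁, c₂ ⊗ a₂) ↦ c₁ c₂ ι(ẽ(a₁, a₂))`.
[cite: Howard2004HeegnerKolyvagin, Lemma 2.1.1 (e_𝔭(t₁ ⊗ α₁, t₂ ⊗ α₂) = e(t₁, t₂^τ) ⊗ α₁α₂)] -/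
theorem eisensteinDualityDatum_e_tmul_tmul (hsymm : ∀ a b : M, eb a b = eb b a)
    (hequiv : ∀ (g : absoluteGaloisGroup K) (a b : M), eb (ρ g a) (ρ (cd.conj g) b) = cyclotomicCharacterModPow K p k g * eb a b)
    (hnd : ∀ w : M, (∀ b : M, eb w b = 0) → w = 0) (hex : ∀ φ : M →+ ZMod (p ^ k), ∃ w : M, ∀ b : M, eb w b = φ b)
    (hκ : ∀ g : absoluteGaloisGroup K,
      p ^ eisensteinLevel (p := p) hm k ∣ κ'.twistExponent (eisensteinLevel (p := p) hm k) g +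
        κ'.twistExponent (eisensteinLevel (p := p) hm k) (cd.conj g))
    (c₁ c₂ : EisensteinCoeff p m k) (a₁ a₂ : M) :
    (eisensteinDualityDatum hm k cd κ' ρ eb hsymm hequiv hnd hex hκ).e (EisensteinCoeff.Twisted.tmul c₁ a₁)
        (EisensteinCoeff.Twisted.tmul c₂ a₂) = c₁ * c₂ * EisensteinCoeff.ofZMod p hm k (eb a₁ a₂) :=
  scalarForm_tmul_tmul (EisensteinCoeff.ofZMod p hm k) eb c₁ c₂ a₁ a₂

end ZpExtension

end Literature.NumberTheory.EllipticCurves
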